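/-
Copyright (c) 2026 the pub-hodgecm2 formalisation cell (harness21).  New file, outside the frozen port manifest.
Origin: seat `prover-pub-hodgecm2-d2bridge-prove-2-g6-0` (Δ2 BRIDGE; ι₁∕Id CHAIN, ASSEMBLER MODULE TABLE v1.2∕v1.3 row I7b-ENGINE, pen; «b» = d2bridge-wb-3;
engine census `HOME/d2bridge/iota1/I7b-PinSignatures/CENSUS-prove1.md` by d2bridge-prove-1 g6), 2026-08-24.  UNTWISTED twins of the two `thm418Combined_*`
theorems of `D2Bridge/HcmPieces.lean` (:157, :346 — the structure `HcmPieces` itself is generic and is NOT twinned) and of theorems 1 and 4 of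
`D2Bridge/Thm418COfPieces.lean` (:65, :235): `thm418Combined_of_asPrinted_resolvedId` (#6), `thm418Combined_of_asPrinted_resolved_smallId` (#5),
`LiuDictionary.thm418C_of_asPrinted_resolved_smallId` (#4), `LiuDictionary.thm418C_of_asPrinted_of_prop413AsPrinted_perLine_smallId` (#3) — the RESOLVED
INCREMENT «[Liu2021, Thm. 4.18] AS PRINTED ∧ named pins ⟹ `Thm418Combined` ∕ `T.Thm418C`» over `C : Sec42Data (Model.honestP5IdOf h …) isotropicAt`
(files 2+3 of the row folded into ONE module to save one gate level; decl FQNs as announced).  Method (TABLE v1 «COPY + TOKEN FLIP»): statements and proofs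
VERBATIM, with the ONE token flip `Model.honestP5Of h ↦ Model.honestP5IdOf h` (`X_K := M_K`, ✔ `HComp/HonestP5Id.lean` p373641) and the theorem names
suffixed `Id` (same namespaces as the originals); the datum enters these statements only through `C.G ≡ ↥V.adelicFin` (`Model.honestP5IdOf_G`, `rfl`) and
`P5.n = 3` (`rfl`), so no proof changes; generic ingredients (`HcmPieces`, `hcm_of_pieces`, `nonempty_hcmPieces_univ`, `HcmPieces.nonempty_mono`,
`thm418Combined_of_subset_below`, `UniformOmega.rank_intertwiningMap_rhoAt_rest_le_one_of_prop413AsPrinted`) are the TREE's, imported.  THEOREMS ONLY;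
no `def`, no instance, no notation, no named fact introduced, no `sorry`.  HC_CM is NOT proved; «Δ2 BRIDGE CLOSED» is NOT claimed.
-/
import Summits.HodgeConjecture.CorCM.D2Bridge.Iota1.PlacementJunctionAppendixCGood
import Summits.HodgeConjecture.CorCM.D2Bridge.HcmPieces
import Summits.HodgeConjecture.CorCM.D2Bridge.Thm418COfPieces
import HarnessLib

/-!
# ι₁∕Id chain, I7b-ENGINE (2∕3, part A): the resolved increment (`HcmPieces` ⟹ `Thm418Combined`) over the UNTWISTED datum

* `thm418Combined_of_asPrinted_resolvedId` (#6) — `hcm := hcm_of_pieces (pieces …)` into #7;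
* `thm418Combined_of_asPrinted_resolved_smallId` (#5) — pieces only below `Ks μ`, via the tree's generic `nonempty_hcmPieces_univ`,
  `HcmPieces.nonempty_mono`, `thm418Combined_of_subset_below`.
References: [Liu2021] Thm. 4.18 with proof (l. 2232–2268), Thm. 4.18 (1), Rem. 4.17, Lem. 2.4 (1), Def. 4.5 (2), Prop. 4.13 proof l. 2145, App. D Lem. D.1 (1).
HC_CM is NOT proved.
-/

set_option autoImplicit false

noncomputable section

open scoped DirectSum TensorProduct

namespace HodgeCM.Literature.Theta.LiuAlbaneseModuleDatum.D2Bridge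

open HodgeCM.Literature.Theta HodgeCM.Literature.Theta.LiuAlbaneseModuleDatum
open Summit.HodgeConjecture.CorCM
open Literature.AlgebraicGeometry.ShimuraVarieties.UnitaryCanonicalModel
open Literature.NumberTheory.Automorphic.Liu2021 Literature.NumberTheory.Automorphic.Liu2021.AppendixC NumberField
open Literature.RepresentationTheory
open MulAction

universe u v w

/-- **THE RESOLVED INCREMENT (generic over the ported codes, hole-free): S₀ with R3 `hcm` REPLACED by the pieces S1–S4** (R4 `hnvD` ∕ R5 `hmultD`
kept in S₀'s shape here; own-htheta g9's `…_of_good_of_decomposition` l.10749 derives R5 from a Prop-4.13-shaped decomposition — plug it in at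
assembly).  Conclusion `T.Thm418Combined res cmCl` (= `Thm418C` at `T.toLiuAlbaneseModuleDatum, T.res, T.cmClasses`).
[cite: Liu2021, Thm. 4.18 (l. 2232–2245) with proof l. 2247–2268, Thm. 4.18 (1), Lem. 2.4 (1), Def. 4.5 (2), Prop. 4.13 proof l. 2145, App. D Lem. D.1 (1)] -/
theorem thm418Combined_of_asPrinted_resolvedId
    {L : HodgeCM.CMField} {ι₁ : L →+* ℂ} (V : HodgeCM.HermSpace3 L ι₁)
    (h : exists_recordSystem) (Φ : Literature.AlgebraicGeometry.Motives.CMType L)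
    {isotropicAt : ℕ → Prop}
    (C : Sec42Data (Model.honestP5IdOf h ⟨L.K⟩ ι₁ ⟨V.Hm, V.isHermitian, V.signature_ι₁, V.posDef_of_ne⟩ Φ) isotropicAt)
    (T : LiuAlbaneseModuleDatum ↥V.adelicFin (HodgeCM.Level.K : HodgeCM.Level V → Subgroup ↥V.adelicFin))
    {W : HodgeCM.Level V → Type w} [∀ K, AddCommGroup (W K)] [∀ K, Module ℂ (W K)]
    (res : ∀ K : HodgeCM.Level V, T.H →ₗ[ℂ] W K) (cmCl : ∀ K : HodgeCM.Level V, T.Char → Set (W K))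
    (Good : T.Char → Prop) (hbad : ∀ μ : T.Char, T.PhiMu μ → ¬ Good μ → T.block μ = ⊥)
    (R : ∀ μ : T.Char, T.PhiMu μ → Good μ → Thm418Rest C)
    (hLiu : ∀ (μ : T.Char) (hμ : T.PhiMu μ) (hg : Good μ), Thm418AsPrinted (toThm418Data C (R μ hμ hg)))
    (σ : ∀ (μ : T.Char) (hμ : T.PhiMu μ) (hg : Good μ), T.Adm μ → (toThm418Data C (R μ hμ hg)).AdmIndex)
    (hσ : ∀ (μ : T.Char) (hμ : T.PhiMu μ) (hg : Good μ), Function.Injective (σ μ hμ hg))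
    (e : ∀ (μ : T.Char) (hμ : T.PhiMu μ) (hg : Good μ) (a : T.Adm μ),
      T.Ω μ a ≃ₗ[ℂ] (toThm418Data C (R μ hμ hg)).omegaAt (σ μ hμ hg a))
    (he : ∀ (μ : T.Char) (hμ : T.PhiMu μ) (hg : Good μ) (a : T.Adm μ) (g : ↥V.adelicFin) (m : T.Ω μ a),
      e μ hμ hg a (MonoidAlgebra.of ℂ ↥V.adelicFin g • m) = (toThm418Data C (R μ hμ hg)).rhoAt (σ μ hμ hg a) g (e μ hμ hg a m))
    (M : ∀ (μ : T.Char) (hμ : T.PhiMu μ) (hg : Good μ), (toThm418Data C (R μ hμ hg)).Map43RationalData)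
    (jH : ∀ (μ : T.Char) (hμ : T.PhiMu μ) (hg : Good μ), (M μ hμ hg).HB →ₗ[ℂ] T.H)
    (hjHinj : ∀ (μ : T.Char) (hμ : T.PhiMu μ) (hg : Good μ), Function.Injective (jH μ hμ hg))
    (hjH : ∀ (μ : T.Char) (hμ : T.PhiMu μ) (hg : Good μ) (g : ↥V.adelicFin) (x : (M μ hμ hg).HB),
      jH μ hμ hg ((M μ hμ hg).ρB g x) = MonoidAlgebra.of ℂ ↥V.adelicFin g • jH μ hμ hg x)
    -- ── R3 RESOLVED: the four pieces per (good μ, level K) instead of `hcm` ──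
    (pieces : ∀ (μ : T.Char) (hμ : T.PhiMu μ) (hg : Good μ) (K : HodgeCM.Level V),
      HcmPieces (toThm418Data C (R μ hμ hg)) (M μ hμ hg) T.H (jH μ hμ hg) K.K (W K) (res K) (cmCl K μ))
    (hnvD : ∀ (μ : T.Char) (hμ : T.PhiMu μ) (hg : Good μ) (i : (toThm418Data C (R μ hμ hg)).AdmIndex),
      Nontrivial ((toThm418Data C (R μ hμ hg)).omegaAt i))
    (hmultD : ∀ (μ : T.Char) (hμ : T.PhiMu μ) (hg : Good μ) (i : (toThm418Data C (R μ hμ hg)).AdmIndex),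
      Module.rank ℂ (Representation.IntertwiningMap ((toThm418Data C (R μ hμ hg)).rhoAt i)
        (Representation.ofModule' (k := ℂ) (G := ↥V.adelicFin) T.H)) ≤ 1) :
    T.Thm418Combined res cmCl :=
  thm418Combined_of_thm418AsPrintedC_summands_records_of_goodId V h Φ C T res cmCl Good hbad R hLiu σ hσ e he M jH hjHinj hjH
    (fun μ hμ hg K φ => hcm_of_pieces (pieces μ hμ hg K) φ) hnvD hmultD

/-- **THE RESOLVED INCREMENT WITH PIECES ONLY AT SMALL LEVELS**: as `thm418Combined_of_asPrinted_resolvedId`, but `pieces` is asked only for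
the levels `K ≤ Ks μ` (any threshold family `Ks`; at the pin: the level of App. C's `K₀`, below which `res K` IS the restriction to `P_K` of
classes coming from level `K`).  KERNEL: the all-levels lemma at the generator sets `{x | K ≤ Ks μ → x ∈ cmCl K μ}` (= `cmCl K μ` below the
threshold, `univ` above, where `nonempty_hcmPieces_univ` supplies the pieces), then `thm418Combined_of_subset_below`.
[cite: Liu2021, Thm. 4.18 (l. 2232–2245) with proof l. 2247–2268, Thm. 4.18 (1), Lem. 2.4 (1), Def. 4.5 (2), Prop. 4.13 proof l. 2145, App. D Lem. D.1 (1)] -/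
theorem thm418Combined_of_asPrinted_resolved_smallId
    {L : HodgeCM.CMField} {ι₁ : L →+* ℂ} (V : HodgeCM.HermSpace3 L ι₁)
    (h : exists_recordSystem) (Φ : Literature.AlgebraicGeometry.Motives.CMType L)
    {isotropicAt : ℕ → Prop}
    (C : Sec42Data (Model.honestP5IdOf h ⟨L.K⟩ ι₁ ⟨V.Hm, V.isHermitian, V.signature_ι₁, V.posDef_of_ne⟩ Φ) isotropicAt)
    (T : LiuAlbaneseModuleDatum ↥V.adelicFin (HodgeCM.Level.K : HodgeCM.Level V → Subgroup ↥V.adelicFin))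
    {W : HodgeCM.Level V → Type w} [∀ K, AddCommGroup (W K)] [∀ K, Module ℂ (W K)]
    (res : ∀ K : HodgeCM.Level V, T.H →ₗ[ℂ] W K) (cmCl : ∀ K : HodgeCM.Level V, T.Char → Set (W K))
    (Good : T.Char → Prop) (hbad : ∀ μ : T.Char, T.PhiMu μ → ¬ Good μ → T.block μ = ⊥)
    (R : ∀ μ : T.Char, T.PhiMu μ → Good μ → Thm418Rest C)
    (hLiu : ∀ (μ : T.Char) (hμ : T.PhiMu μ) (hg : Good μ), Thm418AsPrinted (toThm418Data C (R μ hμ hg)))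
    (σ : ∀ (μ : T.Char) (hμ : T.PhiMu μ) (hg : Good μ), T.Adm μ → (toThm418Data C (R μ hμ hg)).AdmIndex)
    (hσ : ∀ (μ : T.Char) (hμ : T.PhiMu μ) (hg : Good μ), Function.Injective (σ μ hμ hg))
    (e : ∀ (μ : T.Char) (hμ : T.PhiMu μ) (hg : Good μ) (a : T.Adm μ),
      T.Ω μ a ≃ₗ[ℂ] (toThm418Data C (R μ hμ hg)).omegaAt (σ μ hμ hg a))
    (he : ∀ (μ : T.Char) (hμ : T.PhiMu μ) (hg : Good μ) (a : T.Adm μ) (g : ↥V.adelicFin) (m : T.Ω μ a),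
      e μ hμ hg a (MonoidAlgebra.of ℂ ↥V.adelicFin g • m) = (toThm418Data C (R μ hμ hg)).rhoAt (σ μ hμ hg a) g (e μ hμ hg a m))
    (M : ∀ (μ : T.Char) (hμ : T.PhiMu μ) (hg : Good μ), (toThm418Data C (R μ hμ hg)).Map43RationalData)
    (jH : ∀ (μ : T.Char) (hμ : T.PhiMu μ) (hg : Good μ), (M μ hμ hg).HB →ₗ[ℂ] T.H)
    (hjHinj : ∀ (μ : T.Char) (hμ : T.PhiMu μ) (hg : Good μ), Function.Injective (jH μ hμ hg))
    (hjH : ∀ (μ : T.Char) (hμ : T.PhiMu μ) (hg : Good μ) (g : ↥V.adelicFin) (x : (M μ hμ hg).HB),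
      jH μ hμ hg ((M μ hμ hg).ρB g x) = MonoidAlgebra.of ℂ ↥V.adelicFin g • jH μ hμ hg x)
    -- ── R3 RESOLVED BELOW THE THRESHOLD: the four pieces per (good μ, level K ≤ Ks μ) ──
    (Ks : T.Char → HodgeCM.Level V)
    (pieces : ∀ (μ : T.Char) (hμ : T.PhiMu μ) (hg : Good μ) (K : HodgeCM.Level V), K ≤ Ks μ →
      HcmPieces.{0, v, w} (toThm418Data C (R μ hμ hg)) (M μ hμ hg) T.H (jH μ hμ hg) K.K (W K) (res K) (cmCl K μ))
    (hnvD : ∀ (μ : T.Char) (hμ : T.PhiMu μ) (hg : Good μ) (i : (toThm418Data C (R μ hμ hg)).AdmIndex),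
      Nontrivial ((toThm418Data C (R μ hμ hg)).omegaAt i))
    (hmultD : ∀ (μ : T.Char) (hμ : T.PhiMu μ) (hg : Good μ) (i : (toThm418Data C (R μ hμ hg)).AdmIndex),
      Module.rank ℂ (Representation.IntertwiningMap ((toThm418Data C (R μ hμ hg)).rhoAt i)
        (Representation.ofModule' (k := ℂ) (G := ↥V.adelicFin) T.H)) ≤ 1) :
    T.Thm418Combined res cmCl := by
  have hP : ∀ (μ : T.Char) (hμ : T.PhiMu μ) (hg : Good μ) (K : HodgeCM.Level V),
      Nonempty (HcmPieces.{0, v, w} (toThm418Data C (R μ hμ hg)) (M μ hμ hg) T.H (jH μ hμ hg) K.K (W K) (res K)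
        {x | K ≤ Ks μ → x ∈ cmCl K μ}) := by
    intro μ hμ hg K
    by_cases hK : K ≤ Ks μ
    · exact HcmPieces.nonempty_mono (fun x hx _ => hx) (pieces μ hμ hg K hK)
    · exact HcmPieces.nonempty_mono (fun x _ hK' => absurd hK' hK)
        (Classical.choice (nonempty_hcmPieces_univ _ _ T.H (jH μ hμ hg) K.K (W K) (res K)))
  have h' : T.Thm418Combined res (fun K μ => {x | K ≤ Ks μ → x ∈ cmCl K μ}) :=
    thm418Combined_of_asPrinted_resolvedId V h Φ C T res (fun K μ => {x | K ≤ Ks μ → x ∈ cmCl K μ}) Good hbad R hLiu σ hσ e he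
      M jH hjHinj hjH (fun μ hμ hg K => Classical.choice (hP μ hμ hg K)) hnvD hmultD
  exact thm418Combined_of_subset_below (cmCl' := fun K μ => {x | K ≤ Ks μ → x ∈ cmCl K μ}) Ks
    (fun μ K hK x (hx : K ≤ Ks μ → x ∈ cmCl K μ) => hx hK) h'

end HodgeCM.Literature.Theta.LiuAlbaneseModuleDatum.D2Bridge
end

/-!
# ι₁∕Id chain, I7b-ENGINE (2∕3, part B): `Thm418C` of a real-carrier dictionary from the printed propositions + pins, over the UNTWISTED datum

* `thm418C_of_asPrinted_resolved_smallId` (#4) — one application of #5 at `W K := H¹(P_K; ℂ)`, `res := T.res`, `cmCl := T.cmClasses`;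
* `thm418C_of_asPrinted_of_prop413AsPrinted_perLine_smallId` (#3) — PER-LINE μ-uniform carriers, `hmultD` DERIVED from [Prop 4.13] AS PRINTED by the
  tree's generic `UniformOmega.rank_intertwiningMap_rhoAt_rest_le_one_of_prop413AsPrinted` (`3 ≤ n` is `le_rfl`: `honestP5Id` has `n := 3`).
References: [Liu2021] Thm. 4.18, Thm. 4.18 (1)(2), Prop. 4.13, Def. 4.11, App. D Lem. D.1 (1),(3).  HC_CM is NOT proved.
-/

set_option autoImplicit false

noncomputable section

open scoped TensorProduct DirectSum

namespace HodgeCM.Model.LiuDictionary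

open HodgeCM.Literature.Theta HodgeCM.Literature.Theta.LiuAlbaneseModuleDatum
open HodgeCM.Literature.Theta.LiuAlbaneseModuleDatum.D2Bridge
open Summit.HodgeConjecture.CorCM
open Literature.AlgebraicGeometry.ShimuraVarieties.UnitaryCanonicalModel
open Literature.NumberTheory.Automorphic.Liu2021 Literature.NumberTheory.Automorphic.Liu2021.AppendixC NumberField
open Literature.RepresentationTheory

universe v''

/-- **S∞ with its residual as binders — [Liu2021, Thm. 4.18] AS PRINTED + the named pins ⟹ `T.Thm418C`** for every real-carrier
dictionary `T` (the pin-facing App-C form of the module of record at `W K := H¹(P_K; ℂ)`, `res := T.res`, `cmCl := T.cmClasses`;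
multiplicity `hmultD` kept as a PIN binder — the statement seat's compile-verified S∞ signature `Thm418CAtPinSignature.stmt-g2.lean`,
same name, same binders).  The binders ARE the residual; see the module docstring.
[cite: Liu2021, Thm. 4.18 (l. 2232–2245) with proof l. 2247–2268, Thm. 4.18 (1), (2), Prop. 4.13 (l. 2113–2119), Def. 4.11, Lem. 2.4 (1), Def. 4.5 (2), App. D Lem. D.1 (1), (3)]
[cite: Bump1997, Proposition 4.2.4] -/
theorem thm418C_of_asPrinted_resolved_smallId
    {hHD : Literature.AlgebraicGeometry.HodgeTheory.exists_isReal_hodgeModel}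
    {hI : Literature.AlgebraicGeometry.HodgeTheory.hodgePQ_independent_of_hodgeModel}
    {h₁ : Literature.NumberTheory.Automorphic.PicardCM.BallQuotientUniformised}
    {h₃ : Literature.NumberTheory.Automorphic.PicardCM.CMAbelianVarietyRealised}
    {L : HodgeCM.CMField} {ι₁ : L →+* ℂ} (V : HodgeCM.HermSpace3 L ι₁)
    (h : exists_recordSystem) (Φ : Literature.AlgebraicGeometry.Motives.CMType L)
    {isotropicAt : ℕ → Prop}
    (C : Sec42Data (Model.honestP5IdOf h ⟨L.K⟩ ι₁ ⟨V.Hm, V.isHermitian, V.signature_ι₁, V.posDef_of_ne⟩ Φ) isotropicAt)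
    (T : HodgeCM.Model.LiuDictionary hHD hI h₁ h₃ V)
    (Good : T.Char → Prop) (hbad : ∀ μ : T.Char, T.PhiMu μ → ¬ Good μ → T.block μ = ⊥)
    (R : ∀ μ : T.Char, T.PhiMu μ → Good μ → Thm418Rest C)
    (hLiu : ∀ (μ : T.Char) (hμ : T.PhiMu μ) (hg : Good μ), Thm418AsPrinted (toThm418Data C (R μ hμ hg)))
    (σ : ∀ (μ : T.Char) (hμ : T.PhiMu μ) (hg : Good μ), T.Adm μ → (toThm418Data C (R μ hμ hg)).AdmIndex)
    (hσ : ∀ (μ : T.Char) (hμ : T.PhiMu μ) (hg : Good μ), Function.Injective (σ μ hμ hg))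
    (e : ∀ (μ : T.Char) (hμ : T.PhiMu μ) (hg : Good μ) (a : T.Adm μ),
      T.Ω μ a ≃ₗ[ℂ] (toThm418Data C (R μ hμ hg)).omegaAt (σ μ hμ hg a))
    (he : ∀ (μ : T.Char) (hμ : T.PhiMu μ) (hg : Good μ) (a : T.Adm μ) (g : ↥V.adelicFin) (m : T.Ω μ a),
      e μ hμ hg a (MonoidAlgebra.of ℂ ↥V.adelicFin g • m) = (toThm418Data C (R μ hμ hg)).rhoAt (σ μ hμ hg a) g (e μ hμ hg a m))
    (M : ∀ (μ : T.Char) (hμ : T.PhiMu μ) (hg : Good μ), (toThm418Data C (R μ hμ hg)).Map43RationalData)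
    (jH : ∀ (μ : T.Char) (hμ : T.PhiMu μ) (hg : Good μ), (M μ hμ hg).HB →ₗ[ℂ] T.H)
    (hjHinj : ∀ (μ : T.Char) (hμ : T.PhiMu μ) (hg : Good μ), Function.Injective (jH μ hμ hg))
    (hjH : ∀ (μ : T.Char) (hμ : T.PhiMu μ) (hg : Good μ) (g : ↥V.adelicFin) (x : (M μ hμ hg).HB),
      jH μ hμ hg ((M μ hμ hg).ρB g x) = MonoidAlgebra.of ℂ ↥V.adelicFin g • jH μ hμ hg x)
    -- ── X2 RESOLVED BELOW THE THRESHOLD ──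
    (Ks : T.Char → HodgeCM.Level V)
    (pieces : ∀ (μ : T.Char) (hμ : T.PhiMu μ) (hg : Good μ) (K : HodgeCM.Level V), K ≤ Ks μ →
      HcmPieces.{0, v'', 0} (toThm418Data C (R μ hμ hg)) (M μ hμ hg) T.H (jH μ hμ hg) K.K
        ((HodgeCM.Model.picardCMUniverse hHD hI h₁ h₃).CohC ((HodgeCM.Model.picardCMUniverse hHD hI h₁ h₃).pms L ι₁ V K) 1)
        (T.res K) (T.cmClasses K μ))
    -- ── [Lem D.1 (1)] and [Bump97 Prop 4.2.4 via Prop 4.13] at the rest, as PIN binders ──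
    (hnvD : ∀ (μ : T.Char) (hμ : T.PhiMu μ) (hg : Good μ) (i : (toThm418Data C (R μ hμ hg)).AdmIndex),
      Nontrivial ((toThm418Data C (R μ hμ hg)).omegaAt i))
    (hmultD : ∀ (μ : T.Char) (hμ : T.PhiMu μ) (hg : Good μ) (i : (toThm418Data C (R μ hμ hg)).AdmIndex),
      Module.rank ℂ (Representation.IntertwiningMap ((toThm418Data C (R μ hμ hg)).rhoAt i)
        (Representation.ofModule' (k := ℂ) (G := ↥V.adelicFin) T.H)) ≤ 1) :
    T.Thm418C :=
  -- `Thm418C` is `T.Thm418Combined T.res T.cmClasses` by definition (`LiuDictionary.lean` :212): ONE application of the module of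
  -- record's pin-facing form ✔ `thm418Combined_of_asPrinted_resolved_smallId` (v4) at `W K := H¹(P_K; ℂ)`, `res := T.res`, `cmCl := T.cmClasses`.
  thm418Combined_of_asPrinted_resolved_smallId V h Φ C T.toLiuAlbaneseModuleDatum T.res T.cmClasses Good hbad R hLiu σ hσ e he M jH
    hjHinj hjH Ks pieces hnvD hmultD

/-- **S∞, PER-LINE UNIFORM FAMILIES (DECISION #9)** — theorem 3 with the μ-uniform Weil carriers allowed to depend on the good line:
`U μ hμ hg : UniformOmega C` (value at the pin: `uniformOmegaRep … (2δ_L)⁻¹ (fun _ _ => repOfLine a_μ)`, the representative section THROUGH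
the line of record, so that the Ω-pin transport is literal at every line and NO Hasse-norm input is needed to make one section serve all lines),
and [Liu2021, Prop. 4.13] cited LITERALLY once per good line: `h413 μ hμ hg : Prop413AsPrinted ((U μ hμ hg).prop413Data T.H)` — the SAME printed
proposition (it fixes arbitrary representatives `u` of the Gram classes), instantiated at the section through the line; `h411` ∕ `hsep` likewise.
Theorem 3 is the constant family `fun _ _ _ => U`.
[cite: Liu2021, Thm. 4.18 (l. 2232–2245) with proof l. 2247–2268, Thm. 4.18 (1), (2), Prop. 4.13 (l. 2113–2119), Def. 4.11, Lem. 2.4 (1), Def. 4.5 (2), App. D Lem. D.1 (1), (3)]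
[cite: Bump1997, Proposition 4.2.4] -/
theorem thm418C_of_asPrinted_of_prop413AsPrinted_perLine_smallId
    {hHD : Literature.AlgebraicGeometry.HodgeTheory.exists_isReal_hodgeModel}
    {hI : Literature.AlgebraicGeometry.HodgeTheory.hodgePQ_independent_of_hodgeModel}
    {h₁ : Literature.NumberTheory.Automorphic.PicardCM.BallQuotientUniformised}
    {h₃ : Literature.NumberTheory.Automorphic.PicardCM.CMAbelianVarietyRealised}
    {L : HodgeCM.CMField} {ι₁ : L →+* ℂ} (V : HodgeCM.HermSpace3 L ι₁)
    (h : exists_recordSystem) (Φ : Literature.AlgebraicGeometry.Motives.CMType L)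
    {isotropicAt : ℕ → Prop}
    (C : Sec42Data (Model.honestP5IdOf h ⟨L.K⟩ ι₁ ⟨V.Hm, V.isHermitian, V.signature_ι₁, V.posDef_of_ne⟩ Φ) isotropicAt)
    (T : HodgeCM.Model.LiuDictionary hHD hI h₁ h₃ V)
    (Good : T.Char → Prop) (hbad : ∀ μ : T.Char, T.PhiMu μ → ¬ Good μ → T.block μ = ⊥)
    -- ── the rests: μ-UNIFORM Weil carriers `U` (so that [Prop 4.13] is citable LITERALLY, once per good line, over `(U μ hμ hg).prop413Data T.H`) + a tail per good line;
    --    `R₀` only supplies each line's Hecke character and its conjugate-symplecticity (at the pin: the model's `restOfCharD …`) ──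
    (U : ∀ μ : T.Char, T.PhiMu μ → Good μ → UniformOmega C) (R₀ : ∀ μ : T.Char, T.PhiMu μ → Good μ → Thm418Rest C)
    (tail : ∀ (μ : T.Char) (hμ : T.PhiMu μ) (hg : Good μ), RestTail C (R₀ μ hμ hg).μ (R₀ μ hμ hg).isConjugateSymplectic)
    (hLiu : ∀ (μ : T.Char) (hμ : T.PhiMu μ) (hg : Good μ), Thm418AsPrinted (toThm418Data C ((U μ hμ hg).rest (tail μ hμ hg))))
    (σ : ∀ (μ : T.Char) (hμ : T.PhiMu μ) (hg : Good μ), T.Adm μ → (toThm418Data C ((U μ hμ hg).rest (tail μ hμ hg))).AdmIndex)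
    (hσ : ∀ (μ : T.Char) (hμ : T.PhiMu μ) (hg : Good μ), Function.Injective (σ μ hμ hg))
    (e : ∀ (μ : T.Char) (hμ : T.PhiMu μ) (hg : Good μ) (a : T.Adm μ),
      T.Ω μ a ≃ₗ[ℂ] (toThm418Data C ((U μ hμ hg).rest (tail μ hμ hg))).omegaAt (σ μ hμ hg a))
    (he : ∀ (μ : T.Char) (hμ : T.PhiMu μ) (hg : Good μ) (a : T.Adm μ) (g : ↥V.adelicFin) (m : T.Ω μ a),
      e μ hμ hg a (MonoidAlgebra.of ℂ ↥V.adelicFin g • m) = (toThm418Data C ((U μ hμ hg).rest (tail μ hμ hg))).rhoAt (σ μ hμ hg a) g (e μ hμ hg a m))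
    (M : ∀ (μ : T.Char) (hμ : T.PhiMu μ) (hg : Good μ), (toThm418Data C ((U μ hμ hg).rest (tail μ hμ hg))).Map43RationalData)
    (jH : ∀ (μ : T.Char) (hμ : T.PhiMu μ) (hg : Good μ), (M μ hμ hg).HB →ₗ[ℂ] T.H)
    (hjHinj : ∀ (μ : T.Char) (hμ : T.PhiMu μ) (hg : Good μ), Function.Injective (jH μ hμ hg))
    (hjH : ∀ (μ : T.Char) (hμ : T.PhiMu μ) (hg : Good μ) (g : ↥V.adelicFin) (x : (M μ hμ hg).HB),
      jH μ hμ hg ((M μ hμ hg).ρB g x) = MonoidAlgebra.of ℂ ↥V.adelicFin g • jH μ hμ hg x)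
    -- ── X2 RESOLVED BELOW THE THRESHOLD ──
    (Ks : T.Char → HodgeCM.Level V)
    (pieces : ∀ (μ : T.Char) (hμ : T.PhiMu μ) (hg : Good μ) (K : HodgeCM.Level V), K ≤ Ks μ →
      HcmPieces.{0, v'', 0} (toThm418Data C ((U μ hμ hg).rest (tail μ hμ hg))) (M μ hμ hg) T.H (jH μ hμ hg) K.K
        ((HodgeCM.Model.picardCMUniverse hHD hI h₁ h₃).CohC ((HodgeCM.Model.picardCMUniverse hHD hI h₁ h₃).pms L ι₁ V K) 1)
        (T.res K) (T.cmClasses K μ))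
    -- ── [Lem D.1 (1)] at the rests (PIN binder) ──
    (hnvD : ∀ (μ : T.Char) (hμ : T.PhiMu μ) (hg : Good μ) (i : (toThm418Data C ((U μ hμ hg).rest (tail μ hμ hg))).AdmIndex),
      Nontrivial ((toThm418Data C ((U μ hμ hg).rest (tail μ hμ hg))).omegaAt i))
    -- ── [Prop 4.13] AS PRINTED, cited LITERALLY over the uniform carriers with `H¹_{B,τ'}(A_∞,ℂ)` READ AS the tower `T.H`
    --    (✔ `UniformOmega.prop413Data`, L2.1 p366783), + [Def 4.11] and [Lem D.1 (3)] in its hypotheses' printed shape ──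
    (h413 : ∀ (μ : T.Char) (hμ : T.PhiMu μ) (hg : Good μ), Prop413AsPrinted ((U μ hμ hg).prop413Data T.H))
    (h411 : ∀ (μ : T.Char) (hμ : T.PhiMu μ) (hg : Good μ) (t : ((U μ hμ hg).prop413Data T.H).AdmTriple), IsIrreducibleOrZero (((U μ hμ hg).prop413Data T.H).rhoAt t) ∧
      IsSmoothRep (((U μ hμ hg).prop413Data T.H).rhoAt t) ∧ IsAdmissibleRep (((U μ hμ hg).prop413Data T.H).rhoAt t))
    (hsep : ∀ (μ : T.Char) (hμ : T.PhiMu μ) (hg : Good μ) (s t : ((U μ hμ hg).prop413Data T.H).AdmTriple), Nontrivial (((U μ hμ hg).prop413Data T.H).omegaAt s) →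
      (∃ f : ((U μ hμ hg).prop413Data T.H).omegaAt s ≃ₗ[ℂ] ((U μ hμ hg).prop413Data T.H).omegaAt t,
        ∀ (g : ↥V.adelicFin) (v : ((U μ hμ hg).prop413Data T.H).omegaAt s),
          f (((U μ hμ hg).prop413Data T.H).rhoAt s g v) = ((U μ hμ hg).prop413Data T.H).rhoAt t g (f v)) → s = t)
    (hK : ∃ K : Subgroup ↥V.adelicFin, IsOpenCompact K) :
    T.Thm418C :=
  -- theorem 1 at the rests `(U μ hμ hg).rest (tail μ hμ hg)`, with `hmultD` = L2.1's PAY-OFF ✔ `UniformOmega.rank_intertwiningMap_rhoAt_rest_le_one_of_prop413AsPrinted`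
  -- from the LITERAL `h413` (`3 ≤ n` is `le_rfl` at `honestP5IdOf`, `n := 3` — `Model.honestP5Id_n`; `τ' := ι₁`).
  thm418C_of_asPrinted_resolved_smallId V h Φ C T Good hbad (fun μ hμ hg => (U μ hμ hg).rest (tail μ hμ hg)) hLiu σ hσ e he M jH hjHinj hjH
    Ks pieces hnvD fun μ hμ hg i =>
      (U μ hμ hg).rank_intertwiningMap_rhoAt_rest_le_one_of_prop413AsPrinted T.H (h413 μ hμ hg) le_rfl ι₁ (h411 μ hμ hg) (hsep μ hμ hg) hK (tail μ hμ hg) i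

end HodgeCM.Model.LiuDictionary
end
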